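import Summits.CriticalPhenomena.PercolationContinuityZ3.Theorems.PercNearOneGluingNoHeavyQuantForestBridge
import Summits.CriticalPhenomena.PercolationContinuityZ3.Theorems.PercNearOneGluingNoHeavyQuantRegateMixture
import Summits.CriticalPhenomena.PercolationContinuityZ3.Theorems.PercNearOneGluingNoHeavyQuantThreeRootGateCoupling
import HarnessLib

/-!
# QUANT lane R8, T-DEC: ROOT-PATTERN RE-GATING, k-GENERAL — the forest law as a mixture over the set of OPEN ROOTS (lead g42's
# 'all-subsets opening identity', LEAD-NOTES-G42 N5 (c)(i), in the list binder), re-gated to the common mean: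
# THE SIBLING STEP HOLDS FOR LIGHT-ROOT FORESTS (`Σ qᵢSᵢ ≤ min Sᵢ`) and, in general, for outer gates `a ≤ min Sᵢ / Σ qᵢSᵢ`

builds on p205010 (kernel theorem, internal audit signed; external expert review pending)

Support + definition file (`--supports stmt-CriticalPhenomena-4575`), QUANT lane typer seat prim-quant-stmt (gen 39), rung R8 of
`run/shared/lean/prim/quant/LADDER.md`.  Definitions: the list functionals `Smin`, `Stot`, `xmin`; theorems with standard axioms, no sorries.
Uses typer g39's list binder (`…QuantForestData`, `…QuantForestBridge`: `Sib`, `flaw`, `fmean`, `fgates`, `Sib.TreeOK`), THE RE-GATING LEMMA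
(`…QuantRegateMixture`, here extended by a dead mass: `decAt_gate_of_regate₀`), and census-2 g71's `lconv_top_left_of_le`.

THE IDENTITY.  Splitting each sibling `gate ρᵢ qᵢ = qᵢ·ρᵢ + (1−qᵢ)·δ₀` by whether its root is open: `flaw L = π_∅·δ₀ + Σ_{U ≠ ∅} π_U·R_U`,
`π_U = Π_{i∈U} qᵢ Π_{i∉U}(1−qᵢ)`, `R_U = ∗_{i∈U} ρᵢ` (the trees of `U` OPENED, the others ABSENT — lead g42's absent-tree / subset components),
and `gate_a(flaw L) = Σ_{U≠∅} (π_U s_U/S)·gate_{aS/s_U} R_U` (`s_U = Σ_{i∈U} Sᵢ`, `S = fmean L`).  Each `R_U` is tree-built with FEWER nontrivial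
gates than the forest (no root gates), hence SDEC by the ORACLE of the sibling step; regime `a·S ≤ min_U s_U = min Sᵢ`; floors `x·s_U ≤ S·y_U`
(`y_U` = least sub-forest floor over `U`; the file uses the uniform bound `x·Stot ≤ S·xmin`).

* `decAt_gate_of_regate₀` — the re-gating lemma with a dead mass `π₀·δ₀` (reduction to `decAt_gate_of_regate` by `μ = gate μ′ (1−π₀)`).
* `Smin`, `Stot`, `xmin`; **`flaw_rootPattern`** (the root-pattern mixture with per-piece tree-built certificates of gate count `< fgates L`).
* **`decAt_gate_flaw_rootPattern`**: `TreeOK` siblings, oracle below `fgates L`, `a·fmean L ≤ Smin L`, `x·Stot L ≤ fmean L·xmin L` ⟹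
  `gate (flaw L) a` DEC at every layer at floor `a·x`; **`sdec_flaw_lightRoots`**: if moreover `fmean L ≤ Smin L` (LIGHT ROOTS: the gated total mean
  is at most the smallest opened mean, e.g. `Σ qᵢ ≤ 1` for equal sub-forests) then `SDEC x (ftop L) (flaw L)` — THE LIST FORM OF THE SIBLING STEP
  HOLDS on this family (any width `k`).

HONEST STATUS: a sub-family only (light roots / small outer gates, uniform floor check); `SiblingStep`, `GateStepN`, `FarTreeRow` OPEN; RATE
class log\* / honest sentence unchanged.  [this work]; identity: prim-quant-lead g42 (all-subsets opening), prim-quant-census-2 g70 (absent-tree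
components).  Nothing here is cited as a published result.  The gluing rows served [cite: KozmaNitzan2024, Conjecture 3 (p. 15)]; product measure
[cite: Grimmett1999, §1.3 p. 10].
-/

noncomputable section

open scoped BigOperators

namespace Summit.CriticalPhenomena.PercolationContinuityZ3.Theorems
namespace Quant
namespace LawDec

open Finset

/-! ### The re-gating lemma with a dead mass -/

/-- **THE RE-GATING LEMMA WITH A DEAD MASS**: as `decAt_gate_of_regate`, for `μ = π₀·δ₀ + Σ πᵢ Fᵢ` (`π₀ < 1`): the dead mass is absorbed by
`μ = gate μ′ (1−π₀)` with `μ′` the normalised live part, and `gate μ a = gate μ′ (a(1−π₀))`. [this work] -/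
theorem decAt_gate_of_regate₀ {ι : Type*} [Fintype ι] (M : ℕ) (μ : ℕ → ℝ) (π₀ : ℝ) (π : ι → ℝ) (F : ι → ℕ → ℝ) (t : ι → ℕ)
    (s y : ι → ℝ) {S x a : ℝ}
    (hπ01 : π₀ < 1) (hπ0 : ∀ i, 0 ≤ π i) (hπ1 : π₀ + ∑ i, π i = 1)
    (hmix : ∀ h, μ h = π₀ * (if h = 0 then (1 : ℝ) else 0) + ∑ i, π i * F i h) (hS : ∑ i, π i * s i = S) (hS0 : 0 < S)
    (hμ : ∑ h ∈ Finset.range (M + 1), (h : ℝ) * μ h = S)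
    (hF : ∀ i, 0 < π i → t i ≤ M ∧ (∀ h, 0 ≤ F i h) ∧ (∀ h, t i < h → F i h = 0) ∧ (∑ h ∈ Finset.range (t i + 1), F i h = 1) ∧
      (∑ h ∈ Finset.range (t i + 1), (h : ℝ) * F i h = s i) ∧ 0 < y i ∧ y i < 1 ∧ y i * (t i : ℝ) ≤ s i ∧ SDEC (y i) (t i) (F i))
    (hx0 : 0 < x) (ha0 : 0 < a) (hreg : ∀ i, 0 < π i → a * S ≤ s i) (hfl : ∀ i, 0 < π i → x * s i ≤ S * y i) :
    ∀ j, j < M → DECAt (a * x) j M (gate μ a) := by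
  set c : ℝ := 1 - π₀ with hc
  have hc0 : 0 < c := by rw [hc]; linarith
  -- the live part
  set μ' : ℕ → ℝ := fun h => ∑ i, (π i / c) * F i h with hμ'
  have hgate : gate μ' c = μ := by
    funext h
    rw [gate_apply, hmix h]
    have : c * μ' h = ∑ i, π i * F i h := by
      show c * ∑ i, (π i / c) * F i h = ∑ i, π i * F i h
      rw [Finset.mul_sum]
      exact Finset.sum_congr rfl fun i _ => by field_simp
    rw [this, hc]; ring
  have hπ1' : ∑ i, π i / c = 1 := by
    rw [← Finset.sum_div, div_eq_one_iff_eq hc0.ne', hc]; linarith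
  have hS' : ∑ i, (π i / c) * s i = S / c := by
    rw [eq_div_iff hc0.ne', Finset.sum_mul]
    rw [← hS]
    exact Finset.sum_congr rfl fun i _ => by field_simp
  have hμ'mean : ∑ h ∈ Finset.range (M + 1), (h : ℝ) * μ' h = S / c := by
    have e : ∑ h ∈ Finset.range (M + 1), (h : ℝ) * gate μ' c h = S := by rw [hgate]; exact hμ
    rw [sum_mul_gate] at e
    rw [eq_div_iff hc0.ne']; linarith
  have key := decAt_gate_of_regate M μ' (fun i => π i / c) F t s y (S := S / c) (x := x / c) (a := a * c)
    (fun i => div_nonneg (hπ0 i) hc0.le) hπ1' (fun h => rfl) hS' (div_pos hS0 hc0) hμ'mean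
    (fun i hi => hF i (by have := mul_pos hi hc0; rwa [div_mul_cancel₀ _ hc0.ne'] at this))
    (div_pos hx0 hc0) (mul_pos ha0 hc0)
    (fun i hi => by
      have hπi : 0 < π i := by have := mul_pos hi hc0; rwa [div_mul_cancel₀ _ hc0.ne'] at this
      have : a * c * (S / c) = a * S := by field_simp
      rw [this]; exact hreg i hπi)
    (fun i hi => by
      have hπi : 0 < π i := by have := mul_pos hi hc0; rwa [div_mul_cancel₀ _ hc0.ne'] at this
      rw [div_mul_eq_mul_div, div_mul_eq_mul_div, div_le_div_iff_of_pos_right hc0]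
      exact hfl i hπi)
  intro j hj
  have h1 : a * c * (x / c) = a * x := by field_simp
  have h2 : gate μ' (a * c) = gate μ a := by rw [← hgate, gate_gate]
  have := key j hj
  rwa [h1, h2] at this

/-! ### The list functionals of the root-pattern family -/

/-- the least opened mean `min Sᵢ` (`0` for the empty list). [this work] -/
def Smin : List Sib → ℝ
  | [] => 0
  | [s] => s.mean
  | s :: t :: L => min s.mean (Smin (t :: L))

/-- the total opened mean `Σ Sᵢ`. [this work] -/
def Stot : List Sib → ℝ
  | [] => 0
  | s :: L => Stot L + s.mean

/-- the least sub-forest floor `min x₁ᵢ` (`1` for the empty list). [this work] -/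
def xmin : List Sib → ℝ
  | [] => 1
  | s :: L => min s.x₁ (xmin L)

/-- `Smin (s :: L) ≤ s.mean` and `≤ Smin L` when `L ≠ []`. [this work] -/
theorem Smin_cons_le (s : Sib) (L : List Sib) : Smin (s :: L) ≤ s.mean ∧ (L ≠ [] → Smin (s :: L) ≤ Smin L) := by
  cases L with
  | nil => exact ⟨le_rfl, fun h => absurd rfl h⟩
  | cons t L => exact ⟨min_le_left _ _, fun _ => min_le_right _ _⟩

/-- the opened mean of a valid sibling is nonnegative. [this work] -/
theorem Sib.mean_nonneg (s : Sib) (hs : s.LawOK) : 0 ≤ s.mean :=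
  Finset.sum_nonneg fun h _ => mul_nonneg (Nat.cast_nonneg _) (hs.2.2.1 h)

/-- the opened mean of a tree-built COMPOSITE sibling is positive (`M ≥ 1`, strictness by top-affordability). [this work] -/
theorem Sib.mean_pos {x : ℝ} (s : Sib) (h : s.TreeOK x) : 0 < s.mean := by
  obtain ⟨_, _, _, hT, hnp⟩ := h
  obtain ⟨hx₁0, _, _, ρM, ρ1, ρta⟩ := hT.lawFacts
  have hM : 1 ≤ s.M := by
    by_contra hlt
    have hM0 : s.M = 0 := by omega
    refine hnp 0 (funext fun k => ?_)
    by_cases hk : k = 0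
    · subst hk; rw [if_pos rfl]; have := ρ1; rw [hM0, Finset.sum_range_one] at this; exact this
    · rw [if_neg hk]; exact ρM k (by omega)
  have : 0 < s.x₁ * (s.M : ℝ) := mul_pos hx₁0 (by exact_mod_cast hM)
  exact lt_of_lt_of_le this ρta

/-- `0 ≤ Stot`. [this work] -/
theorem Stot_nonneg (L : List Sib) (hL : ∀ s ∈ L, s.LawOK) : 0 ≤ Stot L := by
  induction L with
  | nil => simp [Stot]
  | cons s L ih =>
    have h1 := ih (fun t ht => hL t (List.mem_cons_of_mem s ht))
    have h2 := s.mean_nonneg (hL s List.mem_cons_self)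
    simp only [Stot]; linarith

/-- `0 ≤ fmean`, and `0 < fmean` for a nonempty list of tree-built composite siblings. [this work] -/
theorem fmean_pos {x : ℝ} (L : List Sib) (hL : ∀ s ∈ L, s.TreeOK x) : 0 ≤ fmean L ∧ (L ≠ [] → 0 < fmean L) := by
  induction L with
  | nil => simp [fmean]
  | cons s L ih =>
    have hs := hL s List.mem_cons_self
    have h1 := (ih (fun t ht => hL t (List.mem_cons_of_mem s ht))).1
    have h2 : 0 < s.q * s.mean := mul_pos hs.1 (s.mean_pos hs)
    simp only [fmean]
    exact ⟨by linarith, fun _ => by linarith⟩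

/-! ### The root-pattern mixture -/

/-- **THE ROOT-PATTERN MIXTURE.**  For tree-built siblings at floor `x`: `flaw L = π₀·δ₀ + Σᵢ πᵢ·Fᵢ` where the pieces (open-root sets
`U ≠ ∅`) are the convolutions of the OPENED sub-forests of `U`: each `Fᵢ` a probability law on `{0..tᵢ}`, `tᵢ ≤ ftop L`, of mean `sᵢ` with
`Smin L ≤ sᵢ ≤ Stot L`, TREE-BUILT (`TreeBuiltN yᵢ mᵢ tᵢ Fᵢ`) at a floor `yᵢ` with `xmin L ≤ yᵢ`, `x < yᵢ`, and with `mᵢ + 1 ≤ fgates L`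
nontrivial gates (no root gates); `π₀ = Π(1−qᵢ) < 1` for `L ≠ []`; `Σ πᵢ sᵢ = fmean L`. [this work] -/
theorem flaw_rootPattern {x : ℝ} (hx0 : 0 < x) (hx1 : x < 1) (L : List Sib) (hL : ∀ s ∈ L, s.TreeOK x) :
    ∃ (π₀ : ℝ) (ι : Type) (_ : Fintype ι) (π : ι → ℝ) (t m : ι → ℕ) (s y : ι → ℝ) (F : ι → ℕ → ℝ),
      0 ≤ π₀ ∧ (L ≠ [] → π₀ < 1) ∧ (∀ i, 0 ≤ π i) ∧ (π₀ + ∑ i, π i = 1) ∧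
      (∀ h, flaw L h = π₀ * (if h = 0 then (1 : ℝ) else 0) + ∑ i, π i * F i h) ∧ (∑ i, π i * s i = fmean L) ∧
      (∀ i, t i ≤ ftop L ∧ (∀ h, 0 ≤ F i h) ∧ (∀ h, t i < h → F i h = 0) ∧ (∑ h ∈ Finset.range (t i + 1), F i h = 1) ∧
        (∑ h ∈ Finset.range (t i + 1), (h : ℝ) * F i h = s i) ∧ Smin L ≤ s i ∧ s i ≤ Stot L ∧
        TreeBuiltN (y i) (m i) (t i) (F i) ∧ xmin L ≤ y i ∧ x < y i ∧ y i * (t i : ℝ) ≤ s i ∧ m i + 1 ≤ fgates L) := by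
  classical
  induction L with
  | nil =>
    refine ⟨1, Fin 0, inferInstance, fun _ => 0, fun _ => 0, fun _ => 0, fun _ => 0, fun _ => 0, fun _ => fun _ => 0,
      zero_le_one, fun h => absurd rfl h, fun _ => le_rfl, by simp, fun h => by simp [flaw], by simp [fmean], fun i => i.elim0⟩
  | cons s L ih =>
    obtain ⟨hq0, hq1, hxq, hT, _⟩ := hL s List.mem_cons_self
    obtain ⟨hx₁0, hx₁1, ρ0, ρM, ρ1, ρta⟩ := hT.lawFacts
    have hsL : ∀ t ∈ L, t.TreeOK x := fun t ht => hL t (List.mem_cons_of_mem s ht)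
    obtain ⟨π₀, ι, _, π, t, m, σ, y, F, hπ00, hπ01, hπ0, hπ1, hmix, hπσ, hP⟩ := ih hsL
    have hxx₁ : x < s.x₁ := lt_of_le_of_lt hxq (by nlinarith)
    have hSpos : 0 ≤ s.mean := by
      unfold Sib.mean; exact Finset.sum_nonneg fun h _ => mul_nonneg (Nat.cast_nonneg _) (ρ0 h)
    have hStot0 : 0 ≤ Stot L := Stot_nonneg L (fun t ht => (hsL t ht).lawOK)
    -- pieces of `s :: L`: (open, i), (absent, i), and (s open alone)
    refine ⟨π₀ * (1 - s.q), (Bool × ι) ⊕ Unit, inferInstance,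
      Sum.elim (fun p => (if p.1 then s.q else 1 - s.q) * π p.2) (fun _ => π₀ * s.q),
      Sum.elim (fun p => if p.1 then t p.2 + s.M else t p.2) (fun _ => s.M),
      Sum.elim (fun p => if p.1 then m p.2 + s.n else m p.2) (fun _ => s.n),
      Sum.elim (fun p => if p.1 then σ p.2 + s.mean else σ p.2) (fun _ => s.mean),
      Sum.elim (fun p => if p.1 then min (y p.2) s.x₁ else y p.2) (fun _ => s.x₁),
      Sum.elim (fun p => if p.1 then lconv (t p.2) s.M (F p.2) s.ρ else F p.2) (fun _ => s.ρ),
      mul_nonneg hπ00 (by linarith), fun _ => ?_, ?_, ?_, ?_, ?_, ?_⟩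
    · -- `π₀(1−q) < 1`
      have hsum0 : 0 ≤ ∑ i, π i := Finset.sum_nonneg fun i _ => hπ0 i
      have hπle : π₀ ≤ 1 := by linarith
      nlinarith
    · -- weights nonnegative
      rintro (⟨b, i⟩ | u)
      · cases b <;> simp only [Sum.elim_inl, Bool.false_eq_true, if_false, if_true] <;> nlinarith [hπ0 i]
      · simp only [Sum.elim_inr]; exact mul_nonneg hπ00 hq0.le
    · -- total weight
      simp only [Fintype.sum_sum_type, Fintype.sum_prod_type, Fintype.sum_bool, Sum.elim_inl, Sum.elim_inr, if_true, Bool.false_eq_true,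
        if_false, Finset.univ_unique, Finset.sum_singleton]
      rw [← Finset.sum_add_distrib]
      have e : ∀ i, s.q * π i + (1 - s.q) * π i = π i := fun i => by ring
      simp_rw [e]
      linarith [hπ1]
    · -- the mixture identity
      intro h
      simp only [flaw, Fintype.sum_sum_type, Fintype.sum_prod_type, Fintype.sum_bool, Sum.elim_inl, Sum.elim_inr, if_true,
        Bool.false_eq_true, if_false, Finset.univ_unique, Finset.sum_singleton]
      have e1 : flaw L = fun k => π₀ * (fun k => if k = 0 then (1 : ℝ) else 0) k + 1 * (fun k => ∑ i, π i * F i k) k := by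
        funext k; rw [hmix k]; ring
      have e2 : gate s.ρ s.q = fun k => s.q * s.ρ k + (1 - s.q) * (fun k => if k = 0 then (1 : ℝ) else 0) k :=
        funext fun k => gate_apply s.ρ s.q k
      have hδ : ∀ k, 0 < k → (fun k => if k = 0 then (1 : ℝ) else 0) k = 0 := fun k hk => if_neg (by omega)
      have hfM : ∀ k, ftop L < k → (fun k => ∑ i, π i * F i k) k = 0 := by
        intro k hk
        show ∑ i, π i * F i k = 0
        exact Finset.sum_eq_zero fun i _ => by rw [(hP i).2.2.1 k (lt_of_le_of_lt (hP i).1 hk), mul_zero]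
      rw [e1, lconv_lin_left, e2, lconv_lin_right, lconv_lin_right, lconv_fsum_left, lconv_fsum_left]
      -- the four kinds of terms
      have A : lconv (ftop L) s.M (fun k => if k = 0 then (1 : ℝ) else 0) s.ρ h = s.ρ h := lconv_delta_left _ _ _ ρM h
      have B : lconv (ftop L) s.M (fun k => if k = 0 then (1 : ℝ) else 0) (fun k => if k = 0 then (1 : ℝ) else 0) h
          = (if h = 0 then (1 : ℝ) else 0) := lconv_delta_left _ _ _ (fun k hk => if_neg (by omega)) h
      have C : ∀ i, lconv (ftop L) s.M (F i) s.ρ h = lconv (t i) s.M (F i) s.ρ h :=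
        fun i => lconv_top_left_of_le (t i) (ftop L) s.M (F i) s.ρ (hP i).1 (hP i).2.2.1 h
      have D : ∀ i, lconv (ftop L) s.M (F i) (fun k => if k = 0 then (1 : ℝ) else 0) h = F i h :=
        fun i => lconv_delta_right _ _ _ (fun k hk => (hP i).2.2.1 k (lt_of_le_of_lt (hP i).1 hk)) h
      rw [A, B]
      simp_rw [C, D]
      have n1 : ∑ i, s.q * π i * lconv (t i) s.M (F i) s.ρ h = s.q * ∑ i, π i * lconv (t i) s.M (F i) s.ρ h := by
        rw [Finset.mul_sum]; exact Finset.sum_congr rfl fun i _ => by ring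
      have n2 : ∑ i, (1 - s.q) * π i * F i h = (1 - s.q) * ∑ i, π i * F i h := by
        rw [Finset.mul_sum]; exact Finset.sum_congr rfl fun i _ => by ring
      rw [n1, n2]
      ring
    · -- `Σ πσ = fmean`
      simp only [fmean, Fintype.sum_sum_type, Fintype.sum_prod_type, Fintype.sum_bool, Sum.elim_inl, Sum.elim_inr, if_true,
        Bool.false_eq_true, if_false, Finset.univ_unique, Finset.sum_singleton]
      rw [← Finset.sum_add_distrib]
      have e : ∀ i, s.q * π i * (σ i + s.mean) + (1 - s.q) * π i * σ i = π i * σ i + (s.q * s.mean) * π i := fun i => by ring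
      simp_rw [e]
      rw [Finset.sum_add_distrib, ← Finset.mul_sum, hπσ]
      have : ∑ i, π i = 1 - π₀ := by linarith [hπ1]
      rw [this]; ring
    · -- piece facts
      rintro (⟨b, i⟩ | u)
      · obtain ⟨hti, F0, FM, F1, Fmean, hSmin, hStot, hTF, hxm, hxy, hyt, hmg⟩ := hP i
        obtain ⟨hy0', hy1', _, _, _, _⟩ := hTF.lawFacts
        cases b
        · -- absent: the piece is unchanged
          simp only [Sum.elim_inl, Bool.false_eq_true, if_false]
          refine ⟨by simp only [ftop]; omega, F0, FM, F1, Fmean, ?_, by simp only [Stot]; linarith, hTF,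
            by simp only [xmin]; exact (min_le_right _ _).trans hxm, hxy, hyt, by simp only [fgates]; omega⟩
          have hne : L ≠ [] := by
            rintro rfl; simp [fgates] at hmg
          exact ((Smin_cons_le s L).2 hne).trans hSmin
        · -- open: the piece convolved with the opened sub-forest
          simp only [Sum.elim_inl, if_true]
          have hσ0 : 0 ≤ σ i := by rw [← Fmean]; exact Finset.sum_nonneg fun h _ => mul_nonneg (Nat.cast_nonneg _) (F0 h)
          have hy'0 : 0 < min (y i) s.x₁ := lt_min hy0' hx₁0
          have hTF' : TreeBuiltN (min (y i) s.x₁) (m i + s.n) (t i + s.M) (lconv (t i) s.M (F i) s.ρ) :=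
            TreeBuiltN.conv (TreeBuiltN.mono hTF hy'0 (min_le_left _ _)) (TreeBuiltN.mono hT hy'0 (min_le_right _ _))
          obtain ⟨_, _, G0, GM, G1, Gta⟩ := hTF'.lawFacts
          refine ⟨by simp only [ftop]; omega, G0, GM, G1, ?_, ?_, by simp only [Stot]; linarith, hTF', ?_, lt_min hxy hxx₁, ?_,
            by simp only [fgates]; omega⟩
          · rw [sum_mul_lconv _ _ _ _ F1 ρ1, Fmean]; rfl
          · linarith [(Smin_cons_le s L).1]
          · simp only [xmin]; exact min_le_min hxm le_rfl |>.trans' (by rw [min_comm])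
          · rw [sum_mul_lconv _ _ _ _ F1 ρ1, Fmean] at Gta; exact Gta
      · -- `s` open alone
        simp only [Sum.elim_inr]
        refine ⟨by simp only [ftop]; omega, ρ0, ρM, ρ1, rfl, (Smin_cons_le s L).1, by simp only [Stot]; linarith, hT,
          by simp only [xmin]; exact min_le_left _ _, hxx₁, ρta, by simp only [fgates]; omega⟩

/-! ### The theorem and the light-root corollary -/

/-- **ROOT-PATTERN RE-GATING (k-general).**  For tree-built siblings at floor `0 < x < 1` (`Sib.TreeOK`), GIVEN the oracle "every tree-built
law with fewer than `fgates L` nontrivial gates is SDEC", an outer gate `0 < a` in the regime `a·fmean L ≤ Smin L` and the uniform floor check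
`x·Stot L ≤ fmean L·xmin L`: `gate (flaw L) a` is DEC at every layer `j < ftop L` at floor `a·x` (pieces = opened sub-forests of the open-root sets,
SDEC by the oracle, re-gated to the common mean). [this work] -/
theorem decAt_gate_flaw_rootPattern {x a : ℝ} (hx0 : 0 < x) (hx1 : x < 1) (L : List Sib) (hL : ∀ s ∈ L, s.TreeOK x)
    (hO : ∀ (x' : ℝ) (n' M' : ℕ) (μ' : ℕ → ℝ), n' < fgates L → TreeBuiltN x' n' M' μ' → SDEC x' M' μ')
    (ha0 : 0 < a) (hreg : a * fmean L ≤ Smin L) (hfl : x * Stot L ≤ fmean L * xmin L) :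
    ∀ j, j < ftop L → DECAt (a * x) j (ftop L) (gate (flaw L) a) := by
  classical
  intro j hj
  have hne : L ≠ [] := by rintro rfl; simp [ftop] at hj
  obtain ⟨π₀, ι, _, π, t, m, σ, y, F, _, hπ01, hπ0, hπ1, hmix, hπσ, hP⟩ := flaw_rootPattern hx0 hx1 L hL
  obtain ⟨_, _, _, fmn⟩ := flaw_facts L (fun s hs => (hL s hs).lawOK)
  have hS0 : 0 < fmean L := (fmean_pos L hL).2 hne
  refine decAt_gate_of_regate₀ (ftop L) (flaw L) π₀ π F t σ y (hπ01 hne) hπ0 hπ1 hmix hπσ hS0 fmn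
    (fun i _ => ?_) hx0 ha0 (fun i _ => hreg.trans (hP i).2.2.2.2.2.1) (fun i _ => ?_) j hj
  · obtain ⟨hti, F0, FM, F1, Fmean, _, _, hTF, _, hxy, hyt, hmg⟩ := hP i
    obtain ⟨hy0', hy1', _, _, _, _⟩ := hTF.lawFacts
    exact ⟨hti, F0, FM, F1, Fmean, hy0', hy1', hyt, hO (y i) (m i) (t i) (F i) (by omega) hTF⟩
  · obtain ⟨_, _, _, _, _, _, hStot, _, hxm, _, _, _⟩ := hP i
    have h1 : x * σ i ≤ x * Stot L := mul_le_mul_of_nonneg_left hStot hx0.le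
    have h2 : fmean L * xmin L ≤ fmean L * y i := mul_le_mul_of_nonneg_left hxm hS0.le
    linarith

/-- **THE SIBLING STEP HOLDS FOR LIGHT-ROOT FORESTS (any width).**  If the gated total mean is at most the smallest opened mean
(`fmean L ≤ Smin L`, e.g. `Σ qᵢ ≤ 1` with equal sub-forests) and the uniform floor check holds, then the forest law is SDEC at `x`, given the
oracle below `fgates L` — the list form of `SiblingStep` on this family. [this work] -/
theorem sdec_flaw_lightRoots {x : ℝ} (hx0 : 0 < x) (hx1 : x < 1) (L : List Sib) (hL : ∀ s ∈ L, s.TreeOK x)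
    (hO : ∀ (x' : ℝ) (n' M' : ℕ) (μ' : ℕ → ℝ), n' < fgates L → TreeBuiltN x' n' M' μ' → SDEC x' M' μ')
    (hlight : fmean L ≤ Smin L) (hfl : x * Stot L ≤ fmean L * xmin L) : SDEC x (ftop L) (flaw L) := by
  intro a ha0 ha1 j hj
  refine decAt_gate_flaw_rootPattern hx0 hx1 L hL hO ha0 ?_ hfl j hj
  have hne : L ≠ [] := by rintro rfl; simp [ftop] at hj
  have : a * fmean L ≤ 1 * fmean L := mul_le_mul_of_nonneg_right ha1 (fmean_pos L hL).1
  linarith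

end LawDec
end Quant
end Summit.CriticalPhenomena.PercolationContinuityZ3.Theorems
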